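import Summits.BirchSwinnertonDyer.Rank1Residual.Partition.CornersEntireFree
import Summits.BirchSwinnertonDyer.Rank1Residual.Partition.HeadlineNoLemma20
import Literature.NumberTheory.EllipticCurves.CyclotomicPAdicLFunctionWeightKProofs
import HarnessLib

/-!
# The corner forms with EVERY DISCHARGED binder fed in: `hmod`, Wuthrich 2014 Lemma 20, and the
# Mazur–Tate–Teitelbaum existence fact (cell `b2b-bsdres`, seat rmap-1 gen 11; RESIDUAL-MAP.md
# §A / §C, §I HEADLINE; kernel 11 of the seat)

HONEST FRAMING (run/shared/lean/b2b/bsd-rank1-residual/, verbatim in every file): the goal of the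
cell is to DELETE the COMBINATION-SHAPED residual classes of the Birch–Swinnerton-Dyer formula for
ALL analytic-rank `≤ 1` elliptic curves over `ℚ` — "full BSD formula for every rank `≤ 1` curve in
class `C`" assembled STRICTLY from published theorems — so that the rank-`≤ 1` remainder becomes
exactly the CONSTRUCTION-SHAPED classes, which are TYPED (missing-input `Prop`s), NOT attempted.
This is not "finishing BSD". Research routes; no claim beyond the stated classes; nothing booked;
no label changes. THEOREMS ONLY (no definition, no named fact, no `sorry`); every published theorem
enters as one of the tree's existing named Literature facts BY NAME.

## What this file records

Three binders of the Partition closing forms of record are REDUNDANT, each for a reason already in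
the tree, but no single form feeds all three:

* `hmod : hasEntireLFunction_rat` — a THEOREM given `hmodP : nonempty_modularParametrizationData`
  (`X2.ClassClosureEntireFree.hasEntireLFunction_rat_of_nonempty_modularParametrizationData`,
  eisenstein-p2; fed by `Partition/CornersEntireFree.lean`, kernel 10, but not by
  `Partition/HeadlineNoLemma20.lean`);
* `hW20 : Wuthrich2014.lemma20_surjective_threeAdic_of_semistable` (CITED-FACTS A9) — DISCHARGED:
  `Wuthrich2014.lemma20_surjective_threeAdic_of_semistable_holds`
  (`Literature/…/Wuthrich2014/ThreeAdicImageSupersingularProofs.lean`; fed by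
  `Partition/HeadlineNoLemma20.lean`, team n1011 seat p02, but not by `CornersEntireFree.lean`);
* `hMTT : exists_isCycPAdicLFunctionWeightK` (CITED-FACTS A78, Mazur–Tate–Teitelbaum 1986
  §I.10–I.14) — DISCHARGED: `exists_isCycPAdicLFunctionWeightK_holds`
  (`Literature/…/CyclotomicPAdicLFunctionWeightKProofs.lean`, x11a gen 16; fed by
  `X11a/ChainMTT.lean` inside the X11a chain, but still a displayed binder of the TWELFTH joint
  §A/§C form `CornersFiveLeTargetA` / `CornersEntireFree`).

This file restates the statements of record with ALL THREE fed — proofs are the tree forms applied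
to the derived `hmod` and the two `…_holds` theorems; hypotheses, case splits and conclusions are
otherwise verbatim:

* `bsdp_of_not_corner_discharged` / `bsdp_of_not_corner_discharged'` — the STRONG PARTIAL THEOREM
  (`Corners.bsdp_of_not_corner` / `…'`, RESIDUAL-MAP §A/§B/§C corner predicates): TWELVE named
  facts (`hSk`, `hBCS`, `hJSW`, `hCGS`, `hGV`, `hGr`, `hmodP`, `hGZK`, `hCM`, `hKob`, `hYZ`,
  `hLLT`) instead of fourteen;
* `bsdp_allCurves_of_not_corner_of_not_cornerF_discharged` — the §I HEADLINE kernel form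
  (`CornersAll.bsdp_allCurves_of_not_corner_of_not_cornerF`): TWELVE named facts;
* `bsdp_three_of_not_corner_discharged` — the `p = 3` form with its seven corners
  (`CornersThree.bsdp_three_of_not_corner`): TWELVE named facts;
* `bsdp_goodOrd_or_mult_of_five_le_rankLeOne_certificates_targetA_discharged` — the TWELFTH joint
  §A/§C form at `p ≥ 5` modulo the per-pair certificate binders and the two X2 closure terms
  (`CornersEntireFree.…_targetA_entireFree`): TWENTY-SEVEN named facts instead of twenty-eight
  (Lemma 20 has no content at `p ≥ 5` and is not a binder there), with its partition form.

PUB\* flags travel with `hBCS` / `hJSW` / `hYZ` / `hKob` exactly as before. Nothing else changes;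
no class, mark, tier or number of RESIDUAL-MAP.md is touched by this file; the originals are not
edited (append-only tree).

References: RESIDUAL-MAP.md §A / §C / §I (SIGNED-FINAL 2026-08-21T15:00Z) and the seat's POST-FINAL
notes; `Partition/Corners.lean`, `Partition/CornersAll.lean`, `Partition/CornersThree.lean`,
`Partition/CornersFiveLeTargetA.lean` (p300504), `Partition/CornersEntireFree.lean` (p310406),
`Partition/HeadlineNoLemma20.lean`, `X11a/ChainMTT.lean`; CITED-FACTS.md A9 / A78 (DISCHARGED);
[Wuthrich2014] Lemma 20 (p. 399); [MazurTateTeitelbaum1986Invent] §I.11, §I.14 (14.3);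
[BCDTJAMS2001] Theorem A; [DiamondShurman2005] Thm. 5.10.2.
-/

noncomputable section

open scoped Classical MatrixGroups ModularForm NumberField

namespace Summit.BirchSwinnertonDyer.Rank1Residual

open CongruenceSubgroup WeierstrassCurve PowerSeries Literature.NumberTheory.EllipticCurves
  Literature.NumberTheory.EllipticCurves.Rank1Residual
  Literature.NumberTheory.EllipticCurves.ModularForms
  Literature.NumberTheory.EllipticCurves.Wuthrich2014
  Literature.NumberTheory.EllipticCurves.GreenbergVatsal2000
  Literature.NumberTheory.EllipticCurves.Rank1Residual.Typed
  Literature.NumberTheory.EllipticCurves.Skinner2016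
  Literature.NumberTheory.EllipticCurves.SteinWuthrich2013
  Literature.NumberTheory.EllipticCurves.Disegni2020
  Literature.NumberTheory.EllipticCurves.EmertonPollackWeston2006
  X2.ClassClosureEntireFree

section Curve

variable {W : WeierstrassCurve ℚ} [W.IsElliptic] [W.IsGloballyMinimal] {p : ℕ} [Fact p.Prime]

/-! ### §1. The corner predicate forms on TWELVE named facts -/

/-- **STRONG PARTIAL THEOREM (non-CM form), TWELVE named facts.** For `W/ℚ` globally minimal
elliptic, NON-CM, of analytic rank `r ≤ 1`, and an ODD prime `p` with `p` good, or `p`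
multiplicative and `r = 0`: `BSD(E,p)` holds unless `(W, p)` lies in one of the eight named
corners X1, X9, X10b, X6 ∧ `r = 0`, X7, X8, X11a, X2 (RESIDUAL-MAP §A/§B/§C) —
`bsdp_of_not_corner_noL20` with
`hmod := hasEntireLFunction_rat_of_nonempty_modularParametrizationData hmodP`. [folklore] -/
theorem bsdp_of_not_corner_discharged (hSk : Skinner2016.thmC_padicValRat_bsd_rank_zero)
    (hBCS : BurungaleCastellaSkinner2025.cor131_padicValRat_bsd_rank_le_one)
    (hJSW : JetchevSkinnerWan2017.thm121_padicValRat_bsd_rank_one)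
    (hCGS : CastellaGrossiSkinner2025.thmD_padicValRat_bsd_rank_le_one)
    (hGV : GreenbergVatsal2000.thm13_charIdeal_eq_of_gvPar) (hGr : greenberg_charValue_rankZero)
    (hmodP : nonempty_modularParametrizationData)
    (hGZK : rank_eq_analyticRank_of_analyticRank_le_one)
    (hCM : bsdTriple_of_hasCM_of_L_one_ne_zero) (hKob : Kobayashi2013.cor14_bsdp_of_cm_rank_one)
    (hYZ : YanZhu2026.thm415_padicValRat_bsd_rank_le_one)
    (hLLT : LiLiuTian2024.thm11_bsdp_of_cm_rank_one)
    (hr : W.analyticRank ≤ 1) (hcm : ¬ W.HasCM) (hp : p ≠ 2)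
    (hdom : Good W p ∨ (Mult W p ∧ W.analyticRank = 0))
    (hX1 : ¬ ClassX1 W p) (hX9 : ¬ ClassX9 W p) (hX10b : ¬ (ClassX10 W p ∧ ¬ Surj W p))
    (hX6 : ¬ (ClassX6 W p ∧ W.analyticRank = 0)) (hX7 : ¬ ClassX7 W p) (hX8 : ¬ ClassX8 W p)
    (hX11a : ¬ ClassX11a W p) (hX2 : ¬ ClassX2 W p) : BSDp W p :=
  bsdp_of_not_corner_noL20 hSk hBCS hJSW hCGS hGV hGr
    (hasEntireLFunction_rat_of_nonempty_modularParametrizationData hmodP) hmodP hGZK hCM hKob hYZ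
    hLLT hr hcm hp hdom hX1 hX9 hX10b hX6 hX7 hX8 hX11a hX2

/-- **STRONG PARTIAL THEOREM, every `E/ℚ` (CM included), TWELVE named facts** — the coordinator's
wording (2026-08-20T22:24Z) as one kernel statement; `bsdp_of_not_corner_noL20'` with `hmod`
derived from `hmodP`. [folklore] -/
theorem bsdp_of_not_corner_discharged' (hSk : Skinner2016.thmC_padicValRat_bsd_rank_zero)
    (hBCS : BurungaleCastellaSkinner2025.cor131_padicValRat_bsd_rank_le_one)
    (hJSW : JetchevSkinnerWan2017.thm121_padicValRat_bsd_rank_one)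
    (hCGS : CastellaGrossiSkinner2025.thmD_padicValRat_bsd_rank_le_one)
    (hGV : GreenbergVatsal2000.thm13_charIdeal_eq_of_gvPar) (hGr : greenberg_charValue_rankZero)
    (hmodP : nonempty_modularParametrizationData)
    (hGZK : rank_eq_analyticRank_of_analyticRank_le_one)
    (hCM : bsdTriple_of_hasCM_of_L_one_ne_zero) (hKob : Kobayashi2013.cor14_bsdp_of_cm_rank_one)
    (hYZ : YanZhu2026.thm415_padicValRat_bsd_rank_le_one)
    (hLLT : LiLiuTian2024.thm11_bsdp_of_cm_rank_one)
    (hr : W.analyticRank ≤ 1) (hp : p ≠ 2)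
    (hdom : Good W p ∨ (Mult W p ∧ W.analyticRank = 0))
    (hX1 : ¬ ClassX1 W p) (hX9 : ¬ ClassX9 W p) (hX10b : ¬ (ClassX10 W p ∧ ¬ Surj W p))
    (hX6 : ¬ (ClassX6 W p ∧ W.analyticRank = 0)) (hX7 : ¬ ClassX7 W p) (hX8 : ¬ ClassX8 W p)
    (hX11a : ¬ ClassX11a W p) (hX2 : ¬ ClassX2 W p) : BSDp W p :=
  bsdp_of_not_corner_noL20' hSk hBCS hJSW hCGS hGV hGr
    (hasEntireLFunction_rat_of_nonempty_modularParametrizationData hmodP) hmodP hGZK hCM hKob hYZ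
    hLLT hr hp hdom hX1 hX9 hX10b hX6 hX7 hX8 hX11a hX2

/-- **The §I HEADLINE kernel form for ALL curves, TWELVE named facts.** For every `E/ℚ` of
analytic rank `≤ 1` and every prime `p` in the domain "`p` odd and (good, or multiplicative with
`r = 0`)" or "`E` has CM", `BSD(E,p)` holds outside the eight non-CM corners and outside `CornerF`
— `bsdp_allCurves_of_not_corner_of_not_cornerF_noL20` with `hmod` derived from `hmodP`.
[folklore] -/
theorem bsdp_allCurves_of_not_corner_of_not_cornerF_discharged
    (hSk : Skinner2016.thmC_padicValRat_bsd_rank_zero)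
    (hBCS : BurungaleCastellaSkinner2025.cor131_padicValRat_bsd_rank_le_one)
    (hJSW : JetchevSkinnerWan2017.thm121_padicValRat_bsd_rank_one)
    (hCGS : CastellaGrossiSkinner2025.thmD_padicValRat_bsd_rank_le_one)
    (hGV : GreenbergVatsal2000.thm13_charIdeal_eq_of_gvPar) (hGr : greenberg_charValue_rankZero)
    (hmodP : nonempty_modularParametrizationData)
    (hGZK : rank_eq_analyticRank_of_analyticRank_le_one)
    (hCM : bsdTriple_of_hasCM_of_L_one_ne_zero) (hKob : Kobayashi2013.cor14_bsdp_of_cm_rank_one)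
    (hYZ : YanZhu2026.thm415_padicValRat_bsd_rank_le_one)
    (hLLT : LiLiuTian2024.thm11_bsdp_of_cm_rank_one)
    (hr : W.analyticRank ≤ 1)
    (hdom : W.HasCM ∨ (p ≠ 2 ∧ (Good W p ∨ (Mult W p ∧ W.analyticRank = 0))))
    (hA : ¬ W.HasCM → ¬ ClassX1 W p ∧ ¬ ClassX9 W p ∧ ¬ (ClassX10 W p ∧ ¬ Surj W p) ∧
      ¬ (ClassX6 W p ∧ W.analyticRank = 0) ∧ ¬ ClassX7 W p ∧ ¬ ClassX8 W p ∧
      ¬ ClassX11a W p ∧ ¬ ClassX2 W p)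
    (hF : W.HasCM → ¬ CornerF W p) : BSDp W p :=
  bsdp_allCurves_of_not_corner_of_not_cornerF_noL20 hSk hBCS hJSW hCGS hGV hGr
    (hasEntireLFunction_rat_of_nonempty_modularParametrizationData hmodP) hmodP hGZK hCM hKob hYZ
    hLLT hr hdom hA hF

/-- **STRONG PARTIAL THEOREM AT `p = 3`, every `E/ℚ`, TWELVE named facts** (RESIDUAL-MAP §S.5):
with `3` good, or `3` multiplicative and `r = 0`, `BSD(E,3)` holds outside the SEVEN corners at
`3` — X10b, X1@3, X6@3 ∧ `r = 0`, X7@3, X8, X11a@3, X2@3; `bsdp_three_of_not_corner_noL20` with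
`hmod` derived from `hmodP` (`p = 3` is the only prime at which Lemma 20 has content). [folklore] -/
theorem bsdp_three_of_not_corner_discharged (hSk : Skinner2016.thmC_padicValRat_bsd_rank_zero)
    (hBCS : BurungaleCastellaSkinner2025.cor131_padicValRat_bsd_rank_le_one)
    (hJSW : JetchevSkinnerWan2017.thm121_padicValRat_bsd_rank_one)
    (hCGS : CastellaGrossiSkinner2025.thmD_padicValRat_bsd_rank_le_one)
    (hGV : GreenbergVatsal2000.thm13_charIdeal_eq_of_gvPar) (hGr : greenberg_charValue_rankZero)
    (hmodP : nonempty_modularParametrizationData)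
    (hGZK : rank_eq_analyticRank_of_analyticRank_le_one)
    (hCM : bsdTriple_of_hasCM_of_L_one_ne_zero) (hKob : Kobayashi2013.cor14_bsdp_of_cm_rank_one)
    (hYZ : YanZhu2026.thm415_padicValRat_bsd_rank_le_one)
    (hLLT : LiLiuTian2024.thm11_bsdp_of_cm_rank_one)
    (hr : W.analyticRank ≤ 1) (hdom : Good W 3 ∨ (Mult W 3 ∧ W.analyticRank = 0))
    (hX10b : ¬ (ClassX10 W 3 ∧ ¬ Surj W 3)) (hX1 : ¬ ClassX1 W 3)
    (hX6 : ¬ (ClassX6 W 3 ∧ W.analyticRank = 0)) (hX7 : ¬ ClassX7 W 3) (hX8 : ¬ ClassX8 W 3)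
    (hX11a : ¬ ClassX11a W 3) (hX2 : ¬ ClassX2 W 3) : BSDp W 3 :=
  bsdp_three_of_not_corner_noL20 hSk hBCS hJSW hCGS hGV hGr
    (hasEntireLFunction_rat_of_nonempty_modularParametrizationData hmodP) hmodP hGZK hCM hKob hYZ
    hLLT hr hdom hX10b hX1 hX6 hX7 hX8 hX11a hX2

/-! ### §2. The TWELFTH joint form at `p ≥ 5` on TWENTY-SEVEN named facts -/

/-- **Non-CM, `p ≥ 5`, 'good ORDINARY, or MULTIPLICATIVE', analytic rank `≤ 1`, modulo the per-pair
certificate binders of record and the TWO X2 closure terms, `hmod` and `hMTT` discharged: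
TWENTY-SEVEN named facts.** Statement and conclusion of
`CornersEntireFree.bsdp_goodOrd_or_mult_of_five_le_rankLeOne_certificates_targetA_entireFree`
verbatim except that the binder `hMTT : exists_isCycPAdicLFunctionWeightK` is absent — fed by the
tree theorem `exists_isCycPAdicLFunctionWeightK_holds` (Mazur–Tate–Teitelbaum 1986 §I.10–I.14,
CITED-FACTS A78 DISCHARGED). [cite: MazurTateTeitelbaum1986Invent, §I.11 and §I.14 (14.3)] -/
theorem bsdp_goodOrd_or_mult_of_five_le_rankLeOne_certificates_targetA_discharged
    (hBCS : BurungaleCastellaSkinner2025.cor131_padicValRat_bsd_rank_le_one)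
    (hBCSa : burungale_castella_skinner_charIdeal_eq_padicLFunction)
    (hGZK : rank_eq_analyticRank_of_analyticRank_le_one)
    (hCGS : CastellaGrossiSkinner2025.thmD_padicValRat_bsd_rank_le_one)
    (hGVg : GreenbergVatsal2000.thm13_charIdeal_eq_of_gvPar) (hGr : greenberg_charValue_rankZero)
    (hmodP : nonempty_modularParametrizationData)
    (hS : Schneider1985_order_charGenerator) (hPR : perrinRiou_rankOne_leadingTerms)
    (hΩ : realPeriodRat_eq_unit_mul_plusPeriod)
    (hSk : Skinner2016.thmC_padicValRat_bsd_rank_zero) (hA : thmA_charIdeal_multiplicative)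
    (hD : thm1_padicBSD_rankOne_multiplicative)
    (hWu : thm16_charIdeal_dvd_multiplicative_of_reducible)
    (hJs : thm61_splitMultiplicative) (hJn : thm61_nonsplitMultiplicative)
    (hHs : exists_isSplitMultCanonical) (hHn : exists_isMultCanonical)
    (hGS : ∀ (W : WeierstrassCurve ℚ) [W.IsElliptic] [W.IsGloballyMinimal] (p : ℕ) [Fact p.Prime],
      greenberg_stevens (W := W) (p := p))
    (hHida : hida_exists_congruent_ordinary_newform_of_multiplicative)
    (h311e : thm311_cotorsion_weightK_member) (hT1a : thm1_muAlg_of_weightK_member)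
    (hT2 : Wan2015.thm4_rational_weightK_member_of_bdd)
    (hT1b : thm513_transfer_from_weightK_member_of_bdd)
    (h61 : DeligneSerre1974.thm61_exists_adicGaloisRep) (h326 : Hida2000_thm326_ordinary)
    (hKato : kato_charIdeal_dvd_multiplicative_of_surjective)
    (hGV : lambdaMu_multiplicative_of_gvPar) (hTA : X2.TargetA)
    (hcm : ¬ W.HasCM) (hr : W.analyticRank ≤ 1) (h5 : 5 ≤ p) (hdom : GoodOrd W p ∨ Mult W p)
    (hcert1 : ClassX1 W p → GVPar W p →
      ∃ (N : ℕ) (_ : NeZero N) (f : CuspForm (Gamma0 N) 2), IsNewformOf W f ∧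
        ∃ n : ℕ, (p : ℝ) ^ (-n : ℤ) < ‖padicLRiemannSum f (unitRoot W p : ℚ_[p]) 1 n‖)
    (hμ9 : ClassX9 W p → ∀ (κ : ZpExtension ℚ p) (γ : Field.absoluteGaloisGroup ℚ),
        κ.IsCyclotomic → κ.IsTopGenerator γ → IsCyclotomicVariable p γ →
      ∀ (D : W.SelmerDualData κ γ), D.mu = 0)
    (hcert9 : ClassX9 W p → ∀ [NeZero (W.conductorNorm ℤ)]
        (f : CuspForm (CongruenceSubgroup.Gamma0 (W.conductorNorm ℤ)) 2),
        IsNewformOf W f → ∀ (ϖ : ℚ), (ϖ : ℝ) * W.realPeriodRat = plusPeriod f →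
      ∃ n : ℕ, ‖PowerSeries.coeff n
        (PowerSeries.C (ϖ : ℚ_[p]) * padicLFunction f (unitRoot W p : ℚ_[p]))‖ = 1)
    (hSch9 : ClassX9 W p → ∀ Dh : PAdicHeightData W p, Dh.IsCanonical → SchneiderConjecture Dh)
    (hSchN : ∀ (q : ℚ_[p]) (Dh : PAdicHeightData W p), q ≠ 0 → ‖q‖ < 1 → tateJ q = (W.j : ℚ_[p]) →
      IsMultCanonical Dh q → SchneiderConjecture Dh)
    (hSchS : ∀ (Dq : TateParameterData W p) (Dh : PAdicHeightData W p),
      IsSplitMultCanonical Dh Dq → SchneiderConjecture Dh)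
    (hμ11 : ClassX11a W p ∨ (ClassX11b W p ∧ ¬ Ram W p) → Surj W p → X11a.MuAnZeroAt W p)
    (hA1 : ¬ (ClassX1 W p ∧ ¬ GVPar W p)) (hX11a : ¬ (ClassX11a W p ∧ ¬ Surj W p))
    (hX2 : ¬ (ClassX2 W p ∧ ¬ (W.analyticRank = 0 ∧ GVPar W p) ∧
      ¬ (W.analyticRank = 1 ∧ ¬ W.HasSplitMultiplicativeReductionAtPrime p ∧ GVPar W p)))
    (hX11b : ¬ (ClassX11b W p ∧ ¬ Ram W p ∧ (¬ Surj W p ∨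
      (W.HasSplitMultiplicativeReductionAtPrime p ∧
        ¬ ∃ (m : ℕ) (_ : Fact m.Prime), m ≠ p ∧ W.HasMultiplicativeReductionAtPrime m)))) :
    BSDp W p :=
  bsdp_goodOrd_or_mult_of_five_le_rankLeOne_certificates_targetA_entireFree hBCS hBCSa hGZK hCGS
    hGVg hGr hmodP hS hPR hΩ hSk hA hD hWu hJs hJn hHs hHn hGS hHida
    exists_isCycPAdicLFunctionWeightK_holds h311e hT1a hT2 hT1b h61 h326 hKato hGV hTA hcm hr h5
    hdom hcert1 hμ9 hcert9 hSch9 hSchN hSchS hμ11 hA1 hX11a hX2 hX11b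

/-- **Partition form, `p ≥ 5`, 'good ORDINARY, or MULTIPLICATIVE', rank `≤ 1`, `hmod` and `hMTT`
discharged** — the partition form
`CornersEntireFree.bsdp_or_corner_goodOrd_or_mult_of_five_le_certificates_targetA_entireFree` from
the same TWENTY-SEVEN named facts, `hGV` / `hTA`, and per-pair hypotheses. [folklore] -/
theorem bsdp_or_corner_goodOrd_or_mult_of_five_le_certificates_targetA_discharged
    (hBCS : BurungaleCastellaSkinner2025.cor131_padicValRat_bsd_rank_le_one)
    (hBCSa : burungale_castella_skinner_charIdeal_eq_padicLFunction)
    (hGZK : rank_eq_analyticRank_of_analyticRank_le_one)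
    (hCGS : CastellaGrossiSkinner2025.thmD_padicValRat_bsd_rank_le_one)
    (hGVg : GreenbergVatsal2000.thm13_charIdeal_eq_of_gvPar) (hGr : greenberg_charValue_rankZero)
    (hmodP : nonempty_modularParametrizationData)
    (hS : Schneider1985_order_charGenerator) (hPR : perrinRiou_rankOne_leadingTerms)
    (hΩ : realPeriodRat_eq_unit_mul_plusPeriod)
    (hSk : Skinner2016.thmC_padicValRat_bsd_rank_zero) (hA : thmA_charIdeal_multiplicative)
    (hD : thm1_padicBSD_rankOne_multiplicative)
    (hWu : thm16_charIdeal_dvd_multiplicative_of_reducible)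
    (hJs : thm61_splitMultiplicative) (hJn : thm61_nonsplitMultiplicative)
    (hHs : exists_isSplitMultCanonical) (hHn : exists_isMultCanonical)
    (hGS : ∀ (W : WeierstrassCurve ℚ) [W.IsElliptic] [W.IsGloballyMinimal] (p : ℕ) [Fact p.Prime],
      greenberg_stevens (W := W) (p := p))
    (hHida : hida_exists_congruent_ordinary_newform_of_multiplicative)
    (h311e : thm311_cotorsion_weightK_member) (hT1a : thm1_muAlg_of_weightK_member)
    (hT2 : Wan2015.thm4_rational_weightK_member_of_bdd)
    (hT1b : thm513_transfer_from_weightK_member_of_bdd)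
    (h61 : DeligneSerre1974.thm61_exists_adicGaloisRep) (h326 : Hida2000_thm326_ordinary)
    (hKato : kato_charIdeal_dvd_multiplicative_of_surjective)
    (hGV : lambdaMu_multiplicative_of_gvPar) (hTA : X2.TargetA)
    (hcm : ¬ W.HasCM) (hr : W.analyticRank ≤ 1) (h5 : 5 ≤ p) (hdom : GoodOrd W p ∨ Mult W p)
    (hcert1 : ClassX1 W p → GVPar W p →
      ∃ (N : ℕ) (_ : NeZero N) (f : CuspForm (Gamma0 N) 2), IsNewformOf W f ∧
        ∃ n : ℕ, (p : ℝ) ^ (-n : ℤ) < ‖padicLRiemannSum f (unitRoot W p : ℚ_[p]) 1 n‖)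
    (hμ9 : ClassX9 W p → ∀ (κ : ZpExtension ℚ p) (γ : Field.absoluteGaloisGroup ℚ),
        κ.IsCyclotomic → κ.IsTopGenerator γ → IsCyclotomicVariable p γ →
      ∀ (D : W.SelmerDualData κ γ), D.mu = 0)
    (hcert9 : ClassX9 W p → ∀ [NeZero (W.conductorNorm ℤ)]
        (f : CuspForm (CongruenceSubgroup.Gamma0 (W.conductorNorm ℤ)) 2),
        IsNewformOf W f → ∀ (ϖ : ℚ), (ϖ : ℝ) * W.realPeriodRat = plusPeriod f →
      ∃ n : ℕ, ‖PowerSeries.coeff n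
        (PowerSeries.C (ϖ : ℚ_[p]) * padicLFunction f (unitRoot W p : ℚ_[p]))‖ = 1)
    (hSch9 : ClassX9 W p → ∀ Dh : PAdicHeightData W p, Dh.IsCanonical → SchneiderConjecture Dh)
    (hSchN : ∀ (q : ℚ_[p]) (Dh : PAdicHeightData W p), q ≠ 0 → ‖q‖ < 1 → tateJ q = (W.j : ℚ_[p]) →
      IsMultCanonical Dh q → SchneiderConjecture Dh)
    (hSchS : ∀ (Dq : TateParameterData W p) (Dh : PAdicHeightData W p),
      IsSplitMultCanonical Dh Dq → SchneiderConjecture Dh)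
    (hμ11 : ClassX11a W p ∨ (ClassX11b W p ∧ ¬ Ram W p) → Surj W p → X11a.MuAnZeroAt W p) :
    BSDp W p ∨ (ClassX1 W p ∧ ¬ GVPar W p) ∨ (ClassX11a W p ∧ ¬ Surj W p) ∨
      (ClassX2 W p ∧ ¬ (W.analyticRank = 0 ∧ GVPar W p) ∧
        ¬ (W.analyticRank = 1 ∧ ¬ W.HasSplitMultiplicativeReductionAtPrime p ∧ GVPar W p)) ∨
      (ClassX11b W p ∧ ¬ Ram W p ∧ (¬ Surj W p ∨
        (W.HasSplitMultiplicativeReductionAtPrime p ∧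
          ¬ ∃ (m : ℕ) (_ : Fact m.Prime), m ≠ p ∧ W.HasMultiplicativeReductionAtPrime m))) :=
  bsdp_or_corner_goodOrd_or_mult_of_five_le_certificates_targetA_entireFree hBCS hBCSa hGZK hCGS
    hGVg hGr hmodP hS hPR hΩ hSk hA hD hWu hJs hJn hHs hHn hGS hHida
    exists_isCycPAdicLFunctionWeightK_holds h311e hT1a hT2 hT1b h61 h326 hKato hGV hTA hcm hr h5
    hdom hcert1 hμ9 hcert9 hSch9 hSchN hSchS hμ11

end Curve

end Summit.BirchSwinnertonDyer.Rank1Residual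

end
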